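import Mathlib.Algebra.MvPolynomial.Rename
import Literature.Computability.Complexity.Mod2SosDegree
import HarnessLib

/-!
# `MOD2` on an arbitrary finite vertex type; invariance of SOS refutations under renaming

Grigoriev's parity system `MOD2_n` (`Mod2.system n`, `Mod2SosDegree.lean`: "`K_n` has a perfect
matching") is stated on the vertex set `Fin n`. Its SOS degree lower bound (Grigoriev 2001,
Cor. 2) is proved by a reduction whose natural vertex set is a structured type (vertex gadgets of
a Tseitin instance plus padding pairs); this file supplies the (folklore) bookkeeping that lets the
bound be proved on any finite vertex type `P` and transported to `Fin (card P)`: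

* `Mod2On.system P` — the same three families of equations (`X_e² - X_e`; `X_e X_f` for distinct
  edges sharing a vertex; `Σ_{e ∋ i} X_e - 1`) over the edges `KEdgeOn P` of the complete graph on
  `P`; `Mod2.system_eq_mod2On : Mod2.system n = Mod2On.system (Fin n)` (definitional);
* `HasSOSRefutation.of_rename` — a static sum-of-squares refutation is transported along a renaming
  of the variables `σ → τ` and a re-indexing of the equations that together carry the system `S`
  to `S'` (`rename` is a ring homomorphism that does not increase total degree,
  `MvPolynomial.totalDegree_rename_le`);
* `Mod2On.system_rename` — a bijection `φ : P ≃ Q` carries `MOD2` on `P` to `MOD2` on `Q`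
  (`KEdgeOn.congr`, `Mod2On.Idx.congr`), hence
  `Mod2On.hasSOSRefutation_iff : HasSOSRefutation (system P) d ↔ HasSOSRefutation (system Q) d`.

## References

* D. Grigoriev, *Linear lower bound on degrees of Positivstellensatz calculus proofs for the
  parity*, Theoret. Comput. Sci. 259 (2001) 613–622, p. 621 (`MOD2_n`), Lemma 10
  (`MOD2_{k(1+2r)}` on the vertex set of the reduction). [Grigoriev2001TCS]
-/

noncomputable section

open MvPolynomial Finset

namespace Literature.Computability.Complexity

/-! ### Static SOS refutations under renaming -/

/-- **SOS refutations are invariant under renaming.** If `rename f` carries each equation `S i`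
to `S' (e i)` for a re-indexing bijection `e`, then a static sum-of-squares refutation of `S` of
half-degree `d` yields one of `S'` (apply the ring homomorphism `rename f`, which does not raise
total degrees). [cite: Grigoriev2001TCS, Lemma 9 (the degenerate case of a renaming reduction, d₁ = 1)] -/
theorem HasSOSRefutation.of_rename {ι κ σ τ K : Type*} [CommRing K] [Fintype ι] [Fintype κ]
    {S : ι → MvPolynomial σ K} {S' : κ → MvPolynomial τ K} (f : σ → τ) (e : ι ≃ κ)
    (hS : ∀ i, rename f (S i) = S' (e i)) {d : ℕ} (h : HasSOSRefutation S d) :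
    HasSOSRefutation S' d := by
  obtain ⟨m, q, g, hq, hg, hsum⟩ := h
  refine ⟨m, fun l => rename f (q l), fun k => rename f (g (e.symm k)), fun l => ?_, fun k => ?_,
    ?_⟩
  · exact (totalDegree_rename_le _ _).trans (hq l)
  · have : rename f (g (e.symm k)) * S' k = rename f (g (e.symm k) * S (e.symm k)) := by
      rw [map_mul, hS, e.apply_symm_apply]
    rw [this]
    exact (totalDegree_rename_le _ _).trans (hg _)
  · have h2 := congrArg (rename f) hsum
    rw [map_add, map_sum, map_sum, map_neg, map_one] at h2
    rw [← h2]
    congr 1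
    · exact sum_congr rfl fun l _ => (map_mul _ _ _).symm
    · rw [← e.sum_comp]
      refine sum_congr rfl fun i _ => ?_
      dsimp only
      rw [e.symm_apply_apply, map_mul, hS]

/-! ### `MOD2` on an arbitrary finite vertex type -/

/-- The edges of the complete graph on a vertex type `P`: non-diagonal unordered pairs
(`KnEdge n` is the case `P = Fin n`). [cite: Grigoriev2001TCS, p. 621] -/
abbrev KEdgeOn (P : Type*) : Type _ := {e : Sym2 P // ¬ e.IsDiag}

namespace Mod2On

variable (P : Type*) [Fintype P] [DecidableEq P]

/-- Index set of the equations of `MOD2` on the vertex type `P` (as `Mod2.Idx n`): edges;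
ordered pairs of distinct edges sharing a vertex; vertices. [cite: Grigoriev2001TCS, p. 621] -/
abbrev Idx : Type _ :=
  KEdgeOn P ⊕
    {p : KEdgeOn P × KEdgeOn P // p.1 ≠ p.2 ∧ ∃ i : P, i ∈ (p.1 : Sym2 P) ∧ i ∈ (p.2 : Sym2 P)} ⊕
    P

/-- **`MOD2` on the vertex type `P`** ("`K_P` has a perfect matching"): `X_e² - X_e = 0`,
`X_e X_f = 0` (distinct edges through a common vertex), `(Σ_{e ∋ i} X_e) - 1 = 0`.
[cite: Grigoriev2001TCS, p. 621] -/
def system : Idx P → MvPolynomial (KEdgeOn P) ℝ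
  | Sum.inl e => X e ^ 2 - X e
  | Sum.inr (Sum.inl p) => X p.1.1 * X p.1.2
  | Sum.inr (Sum.inr i) => (∑ e ∈ univ.filter (fun e : KEdgeOn P => i ∈ (e : Sym2 P)), X e) - 1

/-- Boolean axioms. [cite: Grigoriev2001TCS, p. 621] -/
@[simp] theorem system_edge (e : KEdgeOn P) : system P (Sum.inl e) = X e ^ 2 - X e := rfl

/-- Disjointness equations. [cite: Grigoriev2001TCS, p. 621] -/
@[simp] theorem system_pair
    (p : {p : KEdgeOn P × KEdgeOn P // p.1 ≠ p.2 ∧ ∃ i : P, i ∈ (p.1 : Sym2 P) ∧ i ∈ (p.2 : Sym2 P)}) :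
    system P (Sum.inr (Sum.inl p)) = X p.1.1 * X p.1.2 := rfl

/-- Vertex equations. [cite: Grigoriev2001TCS, p. 621] -/
@[simp] theorem system_vertex (i : P) :
    system P (Sum.inr (Sum.inr i)) =
      (∑ e ∈ univ.filter (fun e : KEdgeOn P => i ∈ (e : Sym2 P)), X e) - 1 := rfl

end Mod2On

/-- `MOD2_n` is `MOD2` on the vertex type `Fin n` (definitionally). [cite: Grigoriev2001TCS, p. 621] -/
theorem Mod2.system_eq_mod2On (n : ℕ) : Mod2.system n = Mod2On.system (Fin n) := by
  funext ι
  rcases ι with e | p | i <;> rfl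

/-! ### Transport along a bijection of the vertices -/

namespace Mod2On

variable {P Q : Type*}

/-- A bijection of vertices induces one of unordered pairs. [cite: Grigoriev2001TCS, Lemma 10 (renaming the vertex set)] -/
def sym2Congr (φ : P ≃ Q) : Sym2 P ≃ Sym2 Q where
  toFun := Sym2.map φ
  invFun := Sym2.map φ.symm
  left_inv e := by rw [Sym2.map_map, Equiv.symm_comp_self, Sym2.map_id]; rfl
  right_inv e := by rw [Sym2.map_map, Equiv.self_comp_symm, Sym2.map_id]; rfl

/-- Unfolding. [cite: Grigoriev2001TCS, Lemma 10 (renaming the vertex set)] -/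
@[simp] theorem sym2Congr_apply (φ : P ≃ Q) (e : Sym2 P) : sym2Congr φ e = Sym2.map φ e := rfl

/-- A bijection of vertices induces one of the edges of the complete graphs.
[cite: Grigoriev2001TCS, Lemma 10 (renaming the vertex set)] -/
def _root_.Literature.Computability.Complexity.KEdgeOn.congr (φ : P ≃ Q) :
    KEdgeOn P ≃ KEdgeOn Q :=
  (sym2Congr φ).subtypeEquiv fun e => by
    rw [sym2Congr_apply, Sym2.isDiag_map φ.injective]

/-- Unfolding. [cite: Grigoriev2001TCS, Lemma 10 (renaming the vertex set)] -/
@[simp] theorem coe_kEdgeOnCongr (φ : P ≃ Q) (e : KEdgeOn P) :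
    ((KEdgeOn.congr φ e : KEdgeOn Q) : Sym2 Q) = Sym2.map φ (e : Sym2 P) := rfl

/-- Membership transports: `φ i ∈ φ(e) ↔ i ∈ e`. [cite: Grigoriev2001TCS, Lemma 10 (renaming the vertex set)] -/
theorem mem_kEdgeOnCongr_iff (φ : P ≃ Q) (e : KEdgeOn P) (i : P) :
    φ i ∈ ((KEdgeOn.congr φ e : KEdgeOn Q) : Sym2 Q) ↔ i ∈ (e : Sym2 P) := by
  rw [coe_kEdgeOnCongr, Sym2.mem_map]
  constructor
  · rintro ⟨a, ha, hai⟩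
    rwa [← φ.injective hai]
  · exact fun h => ⟨i, h, rfl⟩

variable [Fintype P] [DecidableEq P] [Fintype Q] [DecidableEq Q]

/-- The induced bijection of equation indices. [cite: Grigoriev2001TCS, Lemma 10 (renaming the vertex set)] -/
def Idx.congr (φ : P ≃ Q) : Idx P ≃ Idx Q :=
  (KEdgeOn.congr φ).sumCongr <|
    (((KEdgeOn.congr φ).prodCongr (KEdgeOn.congr φ)).subtypeEquiv fun p => by
        simp only [Equiv.prodCongr_apply, Prod.map_fst, Prod.map_snd, ne_eq,
          EmbeddingLike.apply_eq_iff_eq]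
        refine and_congr Iff.rfl ⟨?_, ?_⟩
        · rintro ⟨i, h1, h2⟩
          exact ⟨φ i, (mem_kEdgeOnCongr_iff φ _ i).2 h1, (mem_kEdgeOnCongr_iff φ _ i).2 h2⟩
        · rintro ⟨j, h1, h2⟩
          refine ⟨φ.symm j, ?_, ?_⟩
          · rw [← mem_kEdgeOnCongr_iff φ, φ.apply_symm_apply]; exact h1
          · rw [← mem_kEdgeOnCongr_iff φ, φ.apply_symm_apply]; exact h2).sumCongr
      φ

/-- **`MOD2` is natural in the vertex set**: renaming the edge variables along `φ : P ≃ Q`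
carries the equations of `MOD2` on `P` to those of `MOD2` on `Q`.
[cite: Grigoriev2001TCS, Lemma 10 (renaming the vertex set)] -/
theorem system_rename (φ : P ≃ Q) (ι : Idx P) :
    rename (KEdgeOn.congr φ) (system P ι) = system Q (Idx.congr φ ι) := by
  rcases ι with e | p | i
  · simp [Idx.congr, system]
  · simp [Idx.congr, system]
  · simp only [Idx.congr, Equiv.sumCongr_apply, Sum.map_inr, system_vertex, map_sub, map_sum,
      rename_X, map_one]
    congr 1
    refine Finset.sum_equiv (KEdgeOn.congr φ) (fun e => ?_) (fun e _ => rfl)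
    simp only [mem_filter, mem_univ, true_and, mem_kEdgeOnCongr_iff]

/-- **Transport of SOS refutations of `MOD2` along a bijection of the vertices.**
[cite: Grigoriev2001TCS, Lemma 10 (renaming the vertex set)] -/
theorem hasSOSRefutation_of_equiv (φ : P ≃ Q) {d : ℕ} (h : HasSOSRefutation (system P) d) :
    HasSOSRefutation (system Q) d :=
  h.of_rename (KEdgeOn.congr φ) (Idx.congr φ) (system_rename φ)

/-- `MOD2` on equinumerous vertex types is refutable in the same half-degrees.
[cite: Grigoriev2001TCS, Lemma 10 (renaming the vertex set)] -/
theorem hasSOSRefutation_iff (φ : P ≃ Q) (d : ℕ) :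
    HasSOSRefutation (system P) d ↔ HasSOSRefutation (system Q) d :=
  ⟨hasSOSRefutation_of_equiv φ, hasSOSRefutation_of_equiv φ.symm⟩

/-- In particular `MOD2_n`, `n = |P|`, is refutable in half-degree `d` iff `MOD2` on `P` is.
[cite: Grigoriev2001TCS, Lemma 10 (renaming the vertex set)] -/
theorem hasSOSRefutation_fin_iff (P : Type*) [Fintype P] [DecidableEq P] (d : ℕ) :
    HasSOSRefutation (Mod2.system (Fintype.card P)) d ↔ HasSOSRefutation (system P) d := by
  constructor
  · intro h
    exact h.of_rename (KEdgeOn.congr (Fintype.equivFin P).symm)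
      (Idx.congr (Fintype.equivFin P).symm) fun i => by
        rw [show Mod2.system _ i = Mod2On.system _ i from congrFun (Mod2.system_eq_mod2On _) i]
        exact system_rename _ i
  · intro h
    exact h.of_rename (KEdgeOn.congr (Fintype.equivFin P)) (Idx.congr (Fintype.equivFin P))
      fun i => by
        rw [show Mod2.system _ (Idx.congr (Fintype.equivFin P) i) = Mod2On.system _ _ from
          congrFun (Mod2.system_eq_mod2On _) _]
        exact system_rename _ i

end Mod2On

end Literature.Computability.Complexity
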